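import Literature.GroupTheory.CombinatorialGroupTheory.NielsenMoves
import Mathlib.GroupTheory.FreeGroup.Reduce
import Mathlib.Algebra.Group.TypeTags.Basic
import HarnessLib

/-!
# Alternating quadratic words and Zieschang's bifurcations (transport moves)

Topic `Literature/GroupTheory/CombinatorialGroupTheory`.  The word calculus behind Zieschang's
method of *alternating (binary) products* (H. Zieschang, *Alternierende Produkte in freien
Gruppen*, Abh. Math. Sem. Univ. Hamburg 27 (1964); Zieschang–Vogt–Coldewey, *Surfaces and Planar
Discontinuous Groups*, LNM 835 (1980), §5.2, Def. 5.2.1–5.2.3), in the orientable closed case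
(no boundary factors): a word `w` over the symbols `ι` is **alternating quadratic** if every
symbol occurs in it either not at all or exactly twice, once with each exponent
(`IsQuadratic w`: `count (i,true) w = count (i,false) w ≤ 1`) — the boundary word of a
one-face dissection of a closed orientable surface, e.g. the surface relator `∏ [aᵢ, bᵢ]`.
ZVC's *bifurcations* 5.2.2 (c),(d) (`Y_i = X_i X`: slide one factor over its neighbour) are the
special case `|W| = 1` or `|B| = 1` of the **transport move**

  `A · y · W · B · ȳ · C  ↦  A · y · B · W · ȳ · C`      (`y = x_k^{±1}`, `ȳ = y⁻¹`)

which is realised by free-group automorphisms in two ways (`transv_mk_transport_left`,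
`transv_mk_transport_right`): the transvection `y ↦ y · W` and the transvection `y ↦ y · B⁻¹`
(all other generators fixed) both carry the transported word back to the original one.  Hence
the one-relator groups of the two words are isomorphic, and an assignment `X` of the symbols in
a group killing the old word is transformed into one killing the new word by composing with the
automorphism (ZVC 5.2.4: *"Related binary products have the same value"*), the value of the
moved symbol being multiplied by the value of `W` (resp. by the inverse of the value of `B`).

Also here: words avoiding a symbol and the transvections `transvR`, `transvL`, `transv`;
occurrence bookkeeping in quadratic words (`IsQuadratic.count_eq_one_of_mem`, splitting at the
partner letter, the segments between the two occurrences avoid the symbol); the map killing a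
set of symbols (`killHom`) is "delete the letters" (`killHom_mk`); exponent sums
(`count_true_eq_count_false_of_mk_eq_one`).

## References

* H. Zieschang, *Alternierende Produkte in freien Gruppen*, Abh. Math. Sem. Univ. Hamburg 27
  (1964) 13–31. [Zieschang1964]
* H. Zieschang, E. Vogt, H.-D. Coldewey, *Surfaces and Planar Discontinuous Groups*, LNM 835,
  Springer (1980), §5.2 (5.2.1–5.2.5). [ZieschangVogtColdewey1980]
-/

namespace Literature.GroupTheory.CombinatorialGroupTheory

open List

variable {ι : Type*} [DecidableEq ι]

/-! ### Signed generators and words -/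

omit [DecidableEq ι] in
/-- `mk (x :: L) = x · mk L` with the letter read as a signed generator. [folklore] -/
theorem mk_cons_eq_sgen_mul (x : ι × Bool) (L : List (ι × Bool)) :
    FreeGroup.mk (x :: L) = sgen x.1 x.2 * FreeGroup.mk L := by
  rw [sgen, FreeGroup.mul_mk]; rfl

omit [DecidableEq ι] in
/-- `mk (L₁ ++ L₂) = mk L₁ · mk L₂`. [folklore] -/
theorem mk_append (L₁ L₂ : List (ι × Bool)) :
    FreeGroup.mk (L₁ ++ L₂) = FreeGroup.mk L₁ * FreeGroup.mk L₂ :=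
  FreeGroup.mul_mk.symm

omit [DecidableEq ι] in
/-- The formal inverse letter is the inverse signed generator. [folklore] -/
theorem sgen_fst_not (x : ι × Bool) : sgen x.1 (!x.2) = (sgen x.1 x.2)⁻¹ := sgen_not x.1 x.2

/-! ### Words avoiding a symbol -/

/-- The word `L` does not involve the symbol `k`. [folklore] -/
def Avoids (k : ι) (L : List (ι × Bool)) : Prop := ∀ x ∈ L, x.1 ≠ k

omit [DecidableEq ι] in
/-- The empty word avoids everything. [folklore] -/
theorem avoids_nil (k : ι) : Avoids k ([] : List (ι × Bool)) := fun _ h => by simp at h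

omit [DecidableEq ι] in
/-- `Avoids` on a cons. [folklore] -/
theorem avoids_cons {k : ι} {x : ι × Bool} {L : List (ι × Bool)} :
    Avoids k (x :: L) ↔ x.1 ≠ k ∧ Avoids k L := by
  simp [Avoids]

omit [DecidableEq ι] in
/-- `Avoids` on an append. [folklore] -/
theorem avoids_append {k : ι} {L M : List (ι × Bool)} :
    Avoids k (L ++ M) ↔ Avoids k L ∧ Avoids k M := by
  simp only [Avoids, mem_append]
  exact ⟨fun h => ⟨fun x hx => h x (Or.inl hx), fun x hx => h x (Or.inr hx)⟩,
    fun h x hx => hx.elim (h.1 x) (h.2 x)⟩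

omit [DecidableEq ι] in
/-- `Avoids` passes to the formal inverse. [folklore] -/
theorem Avoids.invRev {k : ι} {L : List (ι × Bool)} (h : Avoids k L) : Avoids k (FreeGroup.invRev L) := by
  intro x hx
  simp only [FreeGroup.invRev, mem_reverse, mem_map] at hx
  obtain ⟨y, hy, rfl⟩ := hx
  exact h y hy

/-- A word avoiding `k` iff it contains neither `(k, true)` nor `(k, false)`. [folklore] -/
theorem avoids_iff_count {k : ι} {L : List (ι × Bool)} :
    Avoids k L ↔ L.count (k, true) = 0 ∧ L.count (k, false) = 0 := by
  simp only [Avoids, count_eq_zero]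
  constructor
  · intro h
    exact ⟨fun hm => h _ hm rfl, fun hm => h _ hm rfl⟩
  · rintro ⟨h₁, h₂⟩ ⟨i, b⟩ hx rfl
    cases b
    · exact h₂ hx
    · exact h₁ hx

/-- `xₖ ↦ w` fixes every word avoiding `k`. [folklore] -/
theorem replaceHom_mk_of_avoids (k : ι) (w : FreeGroup ι) {L : List (ι × Bool)} (hL : Avoids k L) :
    replaceHom k w (FreeGroup.mk L) = FreeGroup.mk L := by
  induction L with
  | nil => exact map_one (replaceHom k w)
  | cons x L ih =>
    rw [avoids_cons] at hL
    rw [mk_cons_eq_sgen_mul, map_mul, ih hL.2]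
    congr 1
    obtain ⟨i, b⟩ := x
    cases b
    · rw [show sgen (i, false).1 (i, false).2 = (FreeGroup.of i)⁻¹ from rfl, map_inv,
        replaceHom_of_ne hL.1]
    · rw [show sgen (i, true).1 (i, true).2 = FreeGroup.of i from rfl, replaceHom_of_ne hL.1]

/-! ### Transvections -/

/-- **Right transvection** `xₖ ↦ xₖ · mk L` (`L` avoiding `k`; inverse `xₖ ↦ xₖ · (mk L)⁻¹`), the
other generators fixed. [folklore] -/
noncomputable def transvR (k : ι) (L : List (ι × Bool)) (hL : Avoids k L) : MulAut (FreeGroup ι) :=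
  replaceAut k (FreeGroup.of k * FreeGroup.mk L) (FreeGroup.of k * (FreeGroup.mk L)⁻¹)
    (by rw [map_mul, replaceHom_of_self, replaceHom_mk_of_avoids k _ hL, inv_mul_cancel_right])
    (by rw [map_mul, map_inv, replaceHom_of_self, replaceHom_mk_of_avoids k _ hL,
      mul_inv_cancel_right])

/-- **Left transvection** `xₖ ↦ (mk L)⁻¹ · xₖ` (`L` avoiding `k`; inverse `xₖ ↦ mk L · xₖ`), the
other generators fixed. [folklore] -/
noncomputable def transvL (k : ι) (L : List (ι × Bool)) (hL : Avoids k L) : MulAut (FreeGroup ι) :=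
  replaceAut k ((FreeGroup.mk L)⁻¹ * FreeGroup.of k) (FreeGroup.mk L * FreeGroup.of k)
    (by rw [map_mul, map_inv, replaceHom_mk_of_avoids k _ hL, replaceHom_of_self,
      inv_mul_cancel_left])
    (by rw [map_mul, replaceHom_mk_of_avoids k _ hL, replaceHom_of_self, mul_inv_cancel_left])

/-- **The transvection of the signed generator `y = xₖ^{(s)}` by `L`**: the automorphism with
`y ↦ y · mk L`, the other generators fixed (`transvR` for `s = true`, `transvL` by the formal
inverse, `transvL`, for `s = false`). [folklore] -/
noncomputable def transv (k : ι) (s : Bool) (L : List (ι × Bool)) (hL : Avoids k L) :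
    MulAut (FreeGroup ι) :=
  bif s then transvR k L hL else transvL k L hL

/-- `transvR` on `xₖ`. [folklore] -/
@[simp] theorem transvR_of_self (k : ι) (L : List (ι × Bool)) (hL : Avoids k L) :
    transvR k L hL (FreeGroup.of k) = FreeGroup.of k * FreeGroup.mk L :=
  replaceAut_of_self _ _ _ _ _

/-- `transvL` on `xₖ`. [folklore] -/
@[simp] theorem transvL_of_self (k : ι) (L : List (ι × Bool)) (hL : Avoids k L) :
    transvL k L hL (FreeGroup.of k) = (FreeGroup.mk L)⁻¹ * FreeGroup.of k :=
  replaceAut_of_self _ _ _ _ _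

/-- `transvR` fixes words avoiding `k`. [folklore] -/
theorem transvR_mk_of_avoids (k : ι) (L : List (ι × Bool)) (hL : Avoids k L) {M : List (ι × Bool)}
    (hM : Avoids k M) : transvR k L hL (FreeGroup.mk M) = FreeGroup.mk M :=
  replaceHom_mk_of_avoids k _ hM

/-- `transvL` fixes words avoiding `k`. [folklore] -/
theorem transvL_mk_of_avoids (k : ι) (L : List (ι × Bool)) (hL : Avoids k L) {M : List (ι × Bool)}
    (hM : Avoids k M) : transvL k L hL (FreeGroup.mk M) = FreeGroup.mk M :=
  replaceHom_mk_of_avoids k _ hM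

/-- **`transv k s L` sends `y = xₖ^{(s)}` to `y · mk L`.** [folklore] -/
theorem transv_sgen (k : ι) (s : Bool) (L : List (ι × Bool)) (hL : Avoids k L) :
    transv k s L hL (sgen k s) = sgen k s * FreeGroup.mk L := by
  cases s
  · simp only [transv, cond_false, sgen_false, map_inv, transvL_of_self, mul_inv_rev, inv_inv]
  · simp [transv]

/-- `transv k s L` fixes words avoiding `k`. [folklore] -/
theorem transv_mk_of_avoids (k : ι) (s : Bool) (L : List (ι × Bool)) (hL : Avoids k L)
    {M : List (ι × Bool)} (hM : Avoids k M) : transv k s L hL (FreeGroup.mk M) = FreeGroup.mk M := by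
  cases s
  · exact transvL_mk_of_avoids k L hL hM
  · exact transvR_mk_of_avoids k L hL hM

/-- `transv k s L` fixes the generators other than `xₖ`. [folklore] -/
theorem transv_of_ne (k : ι) (s : Bool) (L : List (ι × Bool)) (hL : Avoids k L) {j : ι} (hj : j ≠ k) :
    transv k s L hL (FreeGroup.of j) = FreeGroup.of j := by
  have : Avoids k [(j, true)] := fun x hx => by simp at hx; simp [hx, hj]
  exact transv_mk_of_avoids k s L hL this

/-- The value of `transv k s L` on `xₖ` itself, in terms of `y = xₖ^{(s)}`:
`xₖ ↦ (y · mk L)^{(s)}`. [folklore] -/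
theorem transv_of_self (k : ι) (s : Bool) (L : List (ι × Bool)) (hL : Avoids k L) :
    transv k s L hL (FreeGroup.of k) =
      bif s then FreeGroup.of k * FreeGroup.mk L else (FreeGroup.mk L)⁻¹ * FreeGroup.of k := by
  cases s <;> simp [transv]

/-! ### The transport move -/

/-- **Transport by the transvection `y ↦ y·W`** (ZVC 5.2.2 (c),(d) for `|W| = 1`): the automorphism
`y ↦ y · mk W` carries `A y B W ȳ C` to `A y W B ȳ C`. [cite: ZieschangVogtColdewey1980, 5.2.2–5.2.4] -/
theorem transv_mk_transport_left (k : ι) (s : Bool) (A W B C : List (ι × Bool))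
    (hA : Avoids k A) (hW : Avoids k W) (hB : Avoids k B) (hC : Avoids k C) :
    transv k s W hW (FreeGroup.mk (A ++ (k, s) :: (B ++ W ++ (k, !s) :: C))) =
      FreeGroup.mk (A ++ (k, s) :: (W ++ B ++ (k, !s) :: C)) := by
  simp only [mk_append, mk_cons_eq_sgen_mul, map_mul, transv_mk_of_avoids _ _ _ _ hA,
    transv_mk_of_avoids _ _ _ _ hB, transv_mk_of_avoids _ _ _ _ hW,
    transv_mk_of_avoids _ _ _ _ hC, sgen_not, map_inv, transv_sgen]
  group

/-- **Transport by the transvection `y ↦ y·B⁻¹`**: the automorphism `y ↦ y · (mk B)⁻¹` also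
carries `A y B W ȳ C` to `A y W B ȳ C`. [cite: ZieschangVogtColdewey1980, 5.2.2–5.2.4] -/
theorem transv_mk_transport_right (k : ι) (s : Bool) (A W B C : List (ι × Bool))
    (hA : Avoids k A) (hW : Avoids k W) (hB : Avoids k B) (hC : Avoids k C) :
    transv k s (FreeGroup.invRev B) hB.invRev (FreeGroup.mk (A ++ (k, s) :: (B ++ W ++ (k, !s) :: C))) =
      FreeGroup.mk (A ++ (k, s) :: (W ++ B ++ (k, !s) :: C)) := by
  simp only [mk_append, mk_cons_eq_sgen_mul, map_mul, transv_mk_of_avoids _ _ _ _ hA,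
    transv_mk_of_avoids _ _ _ _ hB, transv_mk_of_avoids _ _ _ _ hW,
    transv_mk_of_avoids _ _ _ _ hC, sgen_not, map_inv, transv_sgen, ← FreeGroup.inv_mk]
  group

omit [DecidableEq ι] in
/-- The transported word is a permutation of the original one. [folklore] -/
theorem perm_transport (y y' : ι × Bool) (A W B C : List (ι × Bool)) :
    (A ++ y :: (B ++ W ++ y' :: C)) ~ (A ++ y :: (W ++ B ++ y' :: C)) := by
  exact Perm.append_left A (Perm.cons y (Perm.append_right _ perm_append_comm))

omit [DecidableEq ι] in
/-- **Rotation is conjugation**: `mk (M ++ N) = mk M · mk (N ++ M) · (mk M)⁻¹`. [folklore] -/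
theorem mk_append_eq_conj (M N : List (ι × Bool)) :
    FreeGroup.mk (M ++ N) = FreeGroup.mk M * FreeGroup.mk (N ++ M) * (FreeGroup.mk M)⁻¹ := by
  rw [mk_append, mk_append]; group

/-! ### Alternating quadratic words -/

/-- **Alternating quadratic word** (orientable closed case of ZVC Def. 5.2.1): every symbol occurs
either not at all or exactly twice, once with each exponent. [cite: ZieschangVogtColdewey1980, Def. 5.2.1] -/
def IsQuadratic (w : List (ι × Bool)) : Prop :=
  ∀ i, w.count (i, true) = w.count (i, false) ∧ w.count (i, true) ≤ 1

namespace IsQuadratic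

variable {w : List (ι × Bool)}

/-- The empty word is quadratic. [folklore] -/
theorem nil : IsQuadratic ([] : List (ι × Bool)) := fun i => by simp

/-- Quadraticity is invariant under permutations of the letters. [folklore] -/
theorem perm {w' : List (ι × Bool)} (h : IsQuadratic w) (hp : w ~ w') : IsQuadratic w' := fun i => by
  obtain ⟨h₁, h₂⟩ := h i
  rw [hp.count_eq, hp.count_eq] at *
  exact ⟨h₁, h₂⟩

/-- Quadraticity is invariant under rotation. [folklore] -/
theorem rotate {M N : List (ι × Bool)} (h : IsQuadratic (M ++ N)) : IsQuadratic (N ++ M) :=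
  h.perm perm_append_comm

/-- Every letter occurs at most once. [folklore] -/
theorem count_le_one (h : IsQuadratic w) (x : ι × Bool) : w.count x ≤ 1 := by
  obtain ⟨i, b⟩ := x
  cases b
  · rw [← (h i).1]; exact (h i).2
  · exact (h i).2

/-- A letter of a quadratic word occurs exactly once. [folklore] -/
theorem count_eq_one_of_mem (h : IsQuadratic w) {x : ι × Bool} (hx : x ∈ w) : w.count x = 1 :=
  le_antisymm (h.count_le_one x) (count_pos_iff.2 hx)

/-- The partner (formal inverse) of a letter of a quadratic word occurs exactly once.
[folklore] -/
theorem count_partner_eq_one_of_mem (h : IsQuadratic w) {x : ι × Bool} (hx : x ∈ w) :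
    w.count (x.1, !x.2) = 1 := by
  have h1 := h.count_eq_one_of_mem hx
  obtain ⟨i, b⟩ := x
  cases b
  · simpa [(h i).1] using h1
  · simpa [← (h i).1] using h1

/-- The partner of a letter of a quadratic word is a letter. [folklore] -/
theorem partner_mem (h : IsQuadratic w) {x : ι × Bool} (hx : x ∈ w) : (x.1, !x.2) ∈ w :=
  count_pos_iff.1 (by rw [h.count_partner_eq_one_of_mem hx]; exact Nat.one_pos)

/-- Deleting both occurrences of some symbols keeps a word quadratic: a sublist with all counts
of `(i, true)` and `(i, false)` changed by the same amount. General form: if `count (i,true)`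
and `count (i,false)` of `w'` are bounded by those of `w` and have the same difference, `w'` is
quadratic. [folklore] -/
theorem of_count_le (h : IsQuadratic w) {w' : List (ι × Bool)}
    (hle : ∀ i, w'.count (i, true) ≤ w.count (i, true))
    (heq : ∀ i, w'.count (i, true) + w.count (i, false) = w'.count (i, false) + w.count (i, true)) :
    IsQuadratic w' := fun i => by
  obtain ⟨h₁, h₂⟩ := h i
  have := heq i
  have := hle i
  constructor <;> omega

end IsQuadratic

/-- **The segments of a quadratic word cut at the two occurrences of a symbol avoid it.**
[folklore] -/
theorem IsQuadratic.avoids_of_split {k : ι} {t : Bool} {A M C : List (ι × Bool)}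
    (h : IsQuadratic (A ++ (k, t) :: (M ++ (k, !t) :: C))) : Avoids k A ∧ Avoids k M ∧ Avoids k C := by
  have h1 := h.count_le_one (k, t)
  have h2 := h.count_le_one (k, !t)
  simp only [count_append, count_cons, beq_self_eq_true, if_true] at h1 h2
  have e1 : ((k, !t) == (k, t)) = false := by cases t <;> simp
  have e2 : ((k, t) == (k, !t)) = false := by cases t <;> simp
  simp only [e1, e2, if_false, Bool.false_eq_true] at h1 h2
  rw [avoids_iff_count, avoids_iff_count, avoids_iff_count]
  cases t
  · simp only [Bool.not_false] at h1 h2; omega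
  · simp only [Bool.not_true] at h1 h2; omega

/-- **Splitting a quadratic word at a symbol.**  If `(k, s)` is a letter of the quadratic word
`w`, then `w = A ++ (k,t) :: M ++ (k,!t) :: C` for `t = s` or `t = !s`, with `A`, `M`, `C`
avoiding `k`. [folklore] -/
theorem IsQuadratic.exists_split {w : List (ι × Bool)} (h : IsQuadratic w) {k : ι} {s : Bool}
    (hx : (k, s) ∈ w) :
    ∃ (t : Bool) (A M C : List (ι × Bool)), w = A ++ (k, t) :: (M ++ (k, !t) :: C) ∧
      Avoids k A ∧ Avoids k M ∧ Avoids k C := by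
  obtain ⟨A, R, rfl⟩ := append_of_mem hx
  have hp : (k, !s) ∈ A ++ (k, s) :: R := h.partner_mem (x := (k, s)) (by simp)
  rcases mem_append.1 hp with hpA | hpR
  · -- the partner comes first
    obtain ⟨A', M, rfl⟩ := append_of_mem hpA
    have hw : A' ++ (k, !s) :: M ++ (k, s) :: R = A' ++ (k, !s) :: (M ++ (k, !!s) :: R) := by
      simp
    refine ⟨!s, A', M, R, hw, ?_⟩
    rw [hw] at h
    exact h.avoids_of_split
  · rcases mem_cons.1 hpR with hp | hpR
    · have := (Prod.mk.inj hp).2; cases s <;> simp at this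
    · obtain ⟨M, C, rfl⟩ := append_of_mem hpR
      exact ⟨s, A, M, C, rfl, h.avoids_of_split⟩

/-! ### Killing symbols -/

/-- The homomorphism killing the generators in `p` and fixing the others. [folklore] -/
def killHom (p : ι → Prop) [DecidablePred p] : FreeGroup ι →* FreeGroup ι :=
  FreeGroup.lift fun i => if p i then 1 else FreeGroup.of i

omit [DecidableEq ι] in
/-- **Killing symbols is deleting their letters.** [folklore] -/
theorem killHom_mk (p : ι → Prop) [DecidablePred p] (L : List (ι × Bool)) :
    killHom p (FreeGroup.mk L) = FreeGroup.mk (L.filter fun x => ¬ p x.1) := by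
  induction L with
  | nil => exact map_one _
  | cons x L ih =>
    rw [mk_cons_eq_sgen_mul, map_mul, ih, filter_cons]
    obtain ⟨i, b⟩ := x
    by_cases hi : p i
    · have : killHom p (sgen i b) = 1 := by cases b <;> simp [killHom, hi]
      simp [this, hi]
    · have : killHom p (sgen i b) = sgen i b := by cases b <;> simp [killHom, hi]
      simp [this, hi, mk_cons_eq_sgen_mul]

omit [DecidableEq ι] in
/-- A homomorphism out of the free group that kills the generators in `p` factors through
`killHom p`. [folklore] -/
theorem lift_comp_killHom {G : Type*} [Group G] (p : ι → Prop) [DecidablePred p] (X : ι → G)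
    (hX : ∀ i, p i → X i = 1) : (FreeGroup.lift X).comp (killHom p) = FreeGroup.lift X :=
  FreeGroup.ext_hom _ _ fun i => by
    by_cases hi : p i <;> simp [killHom, hi, hX]

omit [DecidableEq ι] in
/-- Pointwise form of `lift_comp_killHom`. [folklore] -/
theorem lift_killHom {G : Type*} [Group G] (p : ι → Prop) [DecidablePred p] (X : ι → G)
    (hX : ∀ i, p i → X i = 1) (x : FreeGroup ι) :
    FreeGroup.lift X (killHom p x) = FreeGroup.lift X x :=
  DFunLike.congr_fun (lift_comp_killHom p X hX) x

/-! ### Exponent sums -/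

/-- The exponent sum of the symbol `i`, a character `F(ι) → ℤ`. [folklore] -/
def symbExpSum (i : ι) : FreeGroup ι →* Multiplicative ℤ :=
  FreeGroup.lift fun j => if j = i then Multiplicative.ofAdd 1 else 1

/-- The exponent sum of `i` in a word is `count (i,true) - count (i,false)`. [folklore] -/
theorem symbExpSum_mk (i : ι) (L : List (ι × Bool)) :
    symbExpSum i (FreeGroup.mk L) = Multiplicative.ofAdd ((L.count (i, true) : ℤ) - L.count (i, false)) := by
  induction L with
  | nil => simp [show (FreeGroup.mk [] : FreeGroup ι) = 1 from rfl]
  | cons x L ih =>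
    rw [mk_cons_eq_sgen_mul, map_mul, ih]
    obtain ⟨j, b⟩ := x
    by_cases hj : j = i
    · subst hj
      cases b
      · simp only [sgen_false, map_inv, symbExpSum, FreeGroup.lift_apply_of, if_true, count_cons,
          beq_self_eq_true, if_true]
        rw [← ofAdd_neg, ← ofAdd_add]
        congr 1
        simp; omega
      · simp only [sgen_true, symbExpSum, FreeGroup.lift_apply_of, if_true, count_cons,
          beq_self_eq_true, if_true]
        rw [← ofAdd_add]
        congr 1
        simp; omega
    · have h1 : symbExpSum i (sgen j b) = 1 := by cases b <;> simp [symbExpSum, hj]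
      rw [h1, one_mul]
      congr 1
      have : ((j, true) == (i, true)) = false := by simp [hj]
      have : ((j, false) == (i, false)) = false := by simp [hj]
      simp_all

/-- **A trivial word is balanced**: if `mk L = 1` then every symbol occurs in `L` as often with
exponent `+1` as with exponent `-1`. [folklore] -/
theorem count_true_eq_count_false_of_mk_eq_one {L : List (ι × Bool)} (h : FreeGroup.mk L = 1) (i : ι) :
    L.count (i, true) = L.count (i, false) := by
  have := symbExpSum_mk i L
  rw [h, map_one] at this
  have h0 : ((L.count (i, true) : ℤ) - L.count (i, false)) = 0 := by
    have := congrArg Multiplicative.toAdd this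
    simpa using this.symm
  omega

end Literature.GroupTheory.CombinatorialGroupTheory
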